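import Literature.NumberTheory.Automorphic.MeyerDifferenceRepresentationProofs
import Literature.NumberTheory.Automorphic.MeyerSummationPoisson
import Literature.NumberTheory.Automorphic.MeyerFiniteIdeleUnits
import HarnessLib

/-!
# Meyer's global difference representation — proofs, III: the unramified reduction

Topic `NumberTheory/Automorphic`; namespace `Literature.NumberTheory.Automorphic.Meyer`. Sibling
PROOF file of `MeyerDifferenceRepresentation`. Step A2/B2 of the proof plan for
`Meyer.spectralRealisation_rat` [Meyer2005, Thm. 5.11]: the compact group `𝒪̂ˣ = ∏_v 𝒪_vˣ` of
integral finite idele units acts TRIVIALLY on the part of any finite-dimensional `C_K`-invariant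
subspace of `H⁰₋ = (H₊ + H₋)/H₊` lying in the joint generalised eigenspace of an unramified
quasi-character `|x|^s` — so that the spectral analysis of `π₋` at `|x|^s` takes place in the
unramified part `V^S`, `S` = infinite places [Meyer2005, §5.1: "`V = lim V^S`"; §5.2].

* `Meyer.congruenceUnits K 𝔫 = U(𝔫) = {u ∈ (𝔸_K^∞)ˣ | u ≡ 1, u⁻¹ ≡ 1 (mod 𝔫𝒪̂)}` — the principal
  congruence subgroups of the finite idele units (**definition**, an `OpenSubgroup`), contained in
  `𝒪̂ˣ = Meyer.integralFiniteUnits` and antitone in `𝔫`;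
* `exists_ideal_forall_smul_eq_of_mem_schwartzBruhat` — **a Schwartz–Bruhat function on
  `(𝔸_K^∞)^ι` is invariant under the dilations by some `U(𝔫)`** (level + tube lemma);
  `exists_ideal_forall_mul_finIdele_eq` — hence so is every `F ∈ 𝒮(𝔸_K)`;
* `exists_openSubgroup_forall_classTranslate₂_eq_of_mem_Hsum` — **every vector of `H₊ + H₋` is
  fixed by an open subgroup of `(𝔸_K^∞)ˣ`** (for `i₊ F` by the invariance of `F`, `Σ`, `𝔉` and
  `|·|`; for `i₋ f` by the definition of `𝒮(C_K)`);
* **`piMinus_finiteUnitClass_eq_self`** — for a finite-dimensional `C_K`-invariant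
  `W ≤ H⁰₋`, `v ∈ W ⊓ V_{|x|^s}` and `u ∈ 𝒪̂ˣ`: `π₋(u) v = v` (finite order + unipotent ⇒
  trivial, `rep_apply_eq_self_of_pow_eq_self_on`).

Everything is proved; one definition (`congruenceUnits`), no named facts.

## References

* R. Meyer, *On a representation of the idele class group related to primes and zeros of
  L-functions*, Duke Math. J. 127 (2005) = arXiv:math/0311468, §5.1–5.2, §5.7 [Meyer2005].
* A. Weil, *Basic Number Theory* (1967), Ch. IV §3 (open subgroups `k_𝔸(P)ˣ`) [WeilBNT1967].
-/

noncomputable section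

open MeasureTheory NumberField IsDedekindDomain Topology
open scoped NNReal

namespace Literature.NumberTheory.Automorphic.Meyer

/-! ### Principal congruence subgroups of the finite idele units -/

section Congruence

variable (K : Type) [Field K] [NumberField K]

/-- **The principal congruence subgroup `U(𝔫)` of the finite idele units**:
`u ∈ (𝔸_K^∞)ˣ` with `u - 1 ∈ 𝔫𝒪̂_K` and `u⁻¹ - 1 ∈ 𝔫𝒪̂_K` (`levelIdeal`); an open subgroup
(Weil's `∏_v (1 + 𝔭_v^{n_v})`, the standard neighbourhood basis of `1` in `∏_v 𝒪_vˣ`).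
[cite: WeilBNT1967, Ch. IV §3] -/
def congruenceUnits (𝔫 : Ideal (𝓞 K)) : OpenSubgroup (FiniteAdeleRing (𝓞 K) K)ˣ where
  carrier := {u | (u : FiniteAdeleRing (𝓞 K) K) - 1 ∈ levelIdeal K 𝔫 ∧
    ((u⁻¹ : (FiniteAdeleRing (𝓞 K) K)ˣ) : FiniteAdeleRing (𝓞 K) K) - 1 ∈ levelIdeal K 𝔫}
  one_mem' := by
    refine ⟨?_, ?_⟩ <;> simp only [Units.val_one, inv_one, sub_self] <;> exact zero_mem _
  mul_mem' {a b} ha hb := by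
    have key : ∀ x y : (FiniteAdeleRing (𝓞 K) K)ˣ,
        (x : FiniteAdeleRing (𝓞 K) K) - 1 ∈ levelIdeal K 𝔫 →
        (y : FiniteAdeleRing (𝓞 K) K) - 1 ∈ levelIdeal K 𝔫 →
        ((x * y : (FiniteAdeleRing (𝓞 K) K)ˣ) : FiniteAdeleRing (𝓞 K) K) - 1 ∈ levelIdeal K 𝔫 := by
      intro x y hx hy
      have hy1 : (y : FiniteAdeleRing (𝓞 K) K) ∈ integralFiniteAdeles K := by
        have : (y : FiniteAdeleRing (𝓞 K) K) = ((y : FiniteAdeleRing (𝓞 K) K) - 1) + 1 := by ring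
        rw [this]
        exact add_mem (mem_integralFiniteAdeles_of_mem_levelIdeal hy) (one_mem _)
      have h : ((x * y : (FiniteAdeleRing (𝓞 K) K)ˣ) : FiniteAdeleRing (𝓞 K) K) - 1 =
          ((x : FiniteAdeleRing (𝓞 K) K) - 1) * y + ((y : FiniteAdeleRing (𝓞 K) K) - 1) := by
        rw [Units.val_mul]; ring
      rw [h]
      exact add_mem (mul_mem_levelIdeal' hx hy1) hy
    refine ⟨key a b ha.1 hb.1, ?_⟩
    rw [mul_inv_rev]
    exact key b⁻¹ a⁻¹ hb.2 ha.2
  inv_mem' {a} ha := ⟨ha.2, by rw [inv_inv]; exact ha.1⟩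
  isOpen' := by
    have hc1 : Continuous fun u : (FiniteAdeleRing (𝓞 K) K)ˣ => (u : FiniteAdeleRing (𝓞 K) K) - 1 :=
      Units.continuous_val.sub continuous_const
    have hc2 : Continuous fun u : (FiniteAdeleRing (𝓞 K) K)ˣ =>
        ((u⁻¹ : (FiniteAdeleRing (𝓞 K) K)ˣ) : FiniteAdeleRing (𝓞 K) K) - 1 :=
      Units.continuous_coe_inv.sub continuous_const
    exact ((isOpen_levelIdeal 𝔫).preimage hc1).inter ((isOpen_levelIdeal 𝔫).preimage hc2)

variable {K}

/-- Membership in `U(𝔫)` (definitional). [folklore] -/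
theorem mem_congruenceUnits_iff {𝔫 : Ideal (𝓞 K)} {u : (FiniteAdeleRing (𝓞 K) K)ˣ} :
    u ∈ congruenceUnits K 𝔫 ↔ (u : FiniteAdeleRing (𝓞 K) K) - 1 ∈ levelIdeal K 𝔫 ∧
      ((u⁻¹ : (FiniteAdeleRing (𝓞 K) K)ˣ) : FiniteAdeleRing (𝓞 K) K) - 1 ∈ levelIdeal K 𝔫 :=
  Iff.rfl

/-- `U(𝔫) ⊆ 𝒪̂ˣ`: congruence units are integral units. [folklore] -/
theorem congruenceUnits_le_integralFiniteUnits (𝔫 : Ideal (𝓞 K)) :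
    ((congruenceUnits K 𝔫 : OpenSubgroup (FiniteAdeleRing (𝓞 K) K)ˣ) :
      Subgroup (FiniteAdeleRing (𝓞 K) K)ˣ) ≤ integralFiniteUnits K := by
  intro u hu v
  have h1 : (u : FiniteAdeleRing (𝓞 K) K) ∈ integralFiniteAdeles K := by
    have : (u : FiniteAdeleRing (𝓞 K) K) = ((u : FiniteAdeleRing (𝓞 K) K) - 1) + 1 := by ring
    rw [this]
    exact add_mem (mem_integralFiniteAdeles_of_mem_levelIdeal hu.1) (one_mem _)
  have h2 : ((u⁻¹ : (FiniteAdeleRing (𝓞 K) K)ˣ) : FiniteAdeleRing (𝓞 K) K) ∈ integralFiniteAdeles K := by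
    have : ((u⁻¹ : (FiniteAdeleRing (𝓞 K) K)ˣ) : FiniteAdeleRing (𝓞 K) K) =
        (((u⁻¹ : (FiniteAdeleRing (𝓞 K) K)ˣ) : FiniteAdeleRing (𝓞 K) K) - 1) + 1 := by ring
    rw [this]
    exact add_mem (mem_integralFiniteAdeles_of_mem_levelIdeal hu.2) (one_mem _)
  exact ⟨h1 v, h2 v⟩

/-- `U(𝔫)` is antitone in `𝔫`: `U(𝔪) ≤ U(𝔫)` for `0 ≠ 𝔪 ≤ 𝔫`. [folklore] -/
theorem congruenceUnits_mono {𝔪 𝔫 : Ideal (𝓞 K)} (h𝔪 : 𝔪 ≠ 0) (h : 𝔪 ≤ 𝔫) :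
    congruenceUnits K 𝔪 ≤ congruenceUnits K 𝔫 := fun _ hu =>
  ⟨levelIdeal_mono K h𝔪 h hu.1, levelIdeal_mono K h𝔪 h hu.2⟩

end Congruence

/-! ### Schwartz–Bruhat functions are invariant under small dilations -/

section Invariance

variable {K : Type} [Field K] [NumberField K]

/-- A level box inside a given neighbourhood of `0 ∈ 𝔸_K^∞`: `𝔫𝒪̂_K ⊆ V` for some `𝔫 ≠ 0`
(the scalar case of `exists_piLevelIdeal_subset`). [folklore] -/
theorem exists_levelIdeal_subset {V : Set (FiniteAdeleRing (𝓞 K) K)} (hV : V ∈ 𝓝 (0 : FiniteAdeleRing (𝓞 K) K)) :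
    ∃ 𝔫 : Ideal (𝓞 K), 𝔫 ≠ 0 ∧ (levelIdeal K 𝔫 : Set (FiniteAdeleRing (𝓞 K) K)) ⊆ V := by
  have hV' : {l : Fin 1 → FiniteAdeleRing (𝓞 K) K | l 0 ∈ V} ∈ 𝓝 (0 : Fin 1 → FiniteAdeleRing (𝓞 K) K) :=
    (continuous_apply (0 : Fin 1)).continuousAt.preimage_mem_nhds (by simpa using hV)
  obtain ⟨𝔫, h𝔫, hsub⟩ := exists_piLevelIdeal_subset K hV'
  refine ⟨𝔫, h𝔫, fun w hw => ?_⟩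
  have : (fun _ : Fin 1 => w) ∈ (piLevelIdeal K (Fin 1) 𝔫 : Set (Fin 1 → FiniteAdeleRing (𝓞 K) K)) := by
    rw [SetLike.mem_coe, mem_piLevelIdeal_iff]
    exact fun _ => hw
  exact hsub this

/-- **Schwartz–Bruhat functions on `(𝔸_K^∞)^ι` are invariant under small dilations**: for `Φ`
locally constant of compact support there is `𝔫 ≠ 0` with `Φ(u x) = Φ(x)` for all `x` and all
`u ∈ U(𝔫)`. Proof: `Φ` has a level `𝔫₀` (`Φ(x + l) = Φ(x)`, `l ∈ (𝔫₀𝒪̂)^ι`); by the tube lemma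
over the compact support there is a neighbourhood `V ∋ 0` with `w x ∈ (𝔫₀𝒪̂)^ι` for `w ∈ V`,
`x ∈ supp Φ`; take `𝔫𝒪̂ ⊆ V` and write `u x = x + (u - 1) x`.
[cite: Meyer2005, §5.1] -/
theorem exists_ideal_forall_smul_eq_of_mem_schwartzBruhat {ι : Type} [Fintype ι]
    {Φ : (ι → FiniteAdeleRing (𝓞 K) K) → ℂ} (hΦ : Φ ∈ SchwartzBruhat (ι → FiniteAdeleRing (𝓞 K) K)) :
    ∃ 𝔫 : Ideal (𝓞 K), 𝔫 ≠ 0 ∧ ∀ u ∈ congruenceUnits K 𝔫, ∀ x : ι → FiniteAdeleRing (𝓞 K) K,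
      Φ ((u : FiniteAdeleRing (𝓞 K) K) • x) = Φ x := by
  obtain ⟨𝔫₀, -, hlev⟩ := exists_level_of_mem_schwartzBruhat K hΦ
  obtain ⟨-, hcs⟩ := (mem_schwartzBruhat_iff).1 hΦ
  -- tube lemma around `{0} × supp Φ`
  have hn : IsOpen {p : FiniteAdeleRing (𝓞 K) K × (ι → FiniteAdeleRing (𝓞 K) K) |
      p.1 • p.2 ∈ (piLevelIdeal K ι 𝔫₀ : Set (ι → FiniteAdeleRing (𝓞 K) K))} :=
    (isOpen_piLevelIdeal K 𝔫₀).preimage (continuous_fst.smul continuous_snd)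
  have hsub : ({0} : Set (FiniteAdeleRing (𝓞 K) K)) ×ˢ tsupport Φ ⊆
      {p : FiniteAdeleRing (𝓞 K) K × (ι → FiniteAdeleRing (𝓞 K) K) |
        p.1 • p.2 ∈ (piLevelIdeal K ι 𝔫₀ : Set (ι → FiniteAdeleRing (𝓞 K) K))} := by
    rintro ⟨w, x⟩ ⟨hw, -⟩
    rw [Set.mem_singleton_iff] at hw
    subst hw
    rw [Set.mem_setOf_eq, zero_smul]
    exact zero_mem _
  obtain ⟨V, T, hV, -, h0V, hT, hVT⟩ := generalized_tube_lemma isCompact_singleton hcs hn hsub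
  have hV0 : V ∈ 𝓝 (0 : FiniteAdeleRing (𝓞 K) K) := hV.mem_nhds (h0V rfl)
  obtain ⟨𝔫, h𝔫, h𝔫V⟩ := exists_levelIdeal_subset hV0
  refine ⟨𝔫, h𝔫, ?_⟩
  -- on the support
  have key : ∀ u ∈ congruenceUnits K 𝔫, ∀ x ∈ tsupport Φ,
      Φ ((u : FiniteAdeleRing (𝓞 K) K) • x) = Φ x := by
    intro u hu x hx
    have h1 : ((u : FiniteAdeleRing (𝓞 K) K) - 1) • x ∈ piLevelIdeal K ι 𝔫₀ := by
      have h1' := hVT (Set.mk_mem_prod (h𝔫V hu.1) (hT hx))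
      rw [Set.mem_setOf_eq] at h1'
      exact h1'
    have h2 := hlev x _ h1
    have h3 : x + ((u : FiniteAdeleRing (𝓞 K) K) - 1) • x = (u : FiniteAdeleRing (𝓞 K) K) • x := by
      rw [sub_smul, one_smul]
      abel
    rw [h3] at h2
    exact h2
  intro u hu x
  by_cases hx : x ∈ tsupport Φ
  · exact key u hu x hx
  · by_cases hx' : (u : FiniteAdeleRing (𝓞 K) K) • x ∈ tsupport Φ
    · have h := key u⁻¹ (inv_mem hu) _ hx'
      rw [smul_smul, Units.inv_mul, one_smul] at h
      exact h.symm
    · rw [image_eq_zero_of_notMem_tsupport hx, image_eq_zero_of_notMem_tsupport hx']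

/-- Every `Φ ∈ 𝒮(𝔸_K^{Fin 1})` is invariant under the coordinatewise dilations by some `U(𝔫)`
(from the factorizable case by linearity). [cite: Meyer2005, §5.1] -/
theorem exists_ideal_forall_mul_finIdele_eq_pi {Φ : (Fin 1 → AdeleRing (𝓞 K) K) → ℂ}
    (hΦ : Φ ∈ piSchwartzBruhat K (Fin 1)) :
    ∃ 𝔫 : Ideal (𝓞 K), 𝔫 ≠ 0 ∧ ∀ u ∈ congruenceUnits K 𝔫, ∀ v : Fin 1 → AdeleRing (𝓞 K) K,
      Φ (fun i => v i * (finIdele K u : AdeleRing (𝓞 K) K)) = Φ v := by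
  rw [piSchwartzBruhat] at hΦ
  induction hΦ using Submodule.span_induction with
  | mem Φ hΦ =>
    obtain ⟨Φinf, Φfin, hfin, rfl⟩ := hΦ
    obtain ⟨𝔫, h𝔫, hinv⟩ := exists_ideal_forall_smul_eq_of_mem_schwartzBruhat hfin
    refine ⟨𝔫, h𝔫, fun u hu v => ?_⟩
    have harch : piArch K (Fin 1) (fun i => v i * (finIdele K u : AdeleRing (𝓞 K) K)) =
        piArch K (Fin 1) v := by
      funext i
      simp only [piArch_apply]
      rw [mul_finIdele_eq]
    have hfinite : piFinite K (Fin 1) (fun i => v i * (finIdele K u : AdeleRing (𝓞 K) K)) =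
        (u : FiniteAdeleRing (𝓞 K) K) • piFinite K (Fin 1) v := by
      funext i
      simp only [piFinite_apply, Pi.smul_apply, smul_eq_mul]
      rw [mul_finIdele_eq, mul_comm]
    simp only [harch, hfinite, hinv u hu]
  | zero => exact ⟨⊤, by simp, fun u _ v => rfl⟩
  | add Φ Ψ _ _ ihΦ ihΨ =>
    obtain ⟨𝔫₁, h𝔫₁, h₁⟩ := ihΦ
    obtain ⟨𝔫₂, h𝔫₂, h₂⟩ := ihΨ
    refine ⟨𝔫₁ * 𝔫₂, mul_ne_zero h𝔫₁ h𝔫₂, fun u hu v => ?_⟩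
    have hu₁ : u ∈ congruenceUnits K 𝔫₁ := congruenceUnits_mono (mul_ne_zero h𝔫₁ h𝔫₂) Ideal.mul_le_right hu
    have hu₂ : u ∈ congruenceUnits K 𝔫₂ := congruenceUnits_mono (mul_ne_zero h𝔫₁ h𝔫₂) Ideal.mul_le_left hu
    simp only [Pi.add_apply]
    rw [h₁ u hu₁ v, h₂ u hu₂ v]
  | smul c Φ _ ih =>
    obtain ⟨𝔫, h𝔫, h⟩ := ih
    refine ⟨𝔫, h𝔫, fun u hu v => ?_⟩
    simp only [Pi.smul_apply]
    rw [h u hu v]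

/-- **Every `F ∈ 𝒮(𝔸_K)` is invariant under the dilations by some `U(𝔫)`**:
`F(y · (1,u)) = F(y)` for all `y ∈ 𝔸_K`, `u ∈ U(𝔫)`. [cite: Meyer2005, §5.1] -/
theorem exists_ideal_forall_mul_finIdele_eq {F : AdeleRing (𝓞 K) K → ℂ}
    (hF : F ∈ schwartzBruhatAdele K) :
    ∃ 𝔫 : Ideal (𝓞 K), 𝔫 ≠ 0 ∧ ∀ u ∈ congruenceUnits K 𝔫, ∀ y : AdeleRing (𝓞 K) K,
      F (y * (finIdele K u : AdeleRing (𝓞 K) K)) = F y := by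
  obtain ⟨𝔫, h𝔫, h⟩ := exists_ideal_forall_mul_finIdele_eq_pi (mem_schwartzBruhatAdele_iff.mp hF)
  exact ⟨𝔫, h𝔫, fun u hu y => h u hu (fun _ => y)⟩

end Invariance

/-! ### Vectors of `H₊ + H₋` are fixed by an open subgroup of the finite idele units -/

section Hsum

variable {K : Type} [Field K] [NumberField K]

/-- `Σ F` is invariant under the finite idele units fixing `F`. [cite: Meyer2005, §5.3] -/
theorem ideleSum_mul_finiteIdele_eq {F : AdeleRing (𝓞 K) K → ℂ} {𝔫 : Ideal (𝓞 K)}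
    (hF : ∀ u ∈ congruenceUnits K 𝔫, ∀ y : AdeleRing (𝓞 K) K,
      F (y * (finIdele K u : AdeleRing (𝓞 K) K)) = F y)
    {u : (FiniteAdeleRing (𝓞 K) K)ˣ} (hu : u ∈ congruenceUnits K 𝔫) (x : GaloisRepresentations.ideleGroup K) :
    ideleSum K F (x * finIdele K u) = ideleSum K F x := by
  unfold ideleSum
  refine tsum_congr fun a => ?_
  rw [Units.val_mul, ← mul_assoc, hF u hu]

/-- `Σ F` on `C_K` is invariant under `finiteUnitClass u` for the units `u` fixing `F`.
[cite: Meyer2005, §5.3] -/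
theorem meyerSum_mul_finiteUnitClass_eq {F : AdeleRing (𝓞 K) K → ℂ} {𝔫 : Ideal (𝓞 K)}
    (hF : ∀ u ∈ congruenceUnits K 𝔫, ∀ y : AdeleRing (𝓞 K) K,
      F (y * (finIdele K u : AdeleRing (𝓞 K) K)) = F y)
    {u : (FiniteAdeleRing (𝓞 K) K)ˣ} (hu : u ∈ congruenceUnits K 𝔫) (c : IdeleClassGroup K) :
    meyerSum K F (c * finiteUnitClass K u) = meyerSum K F c := by
  induction c using QuotientGroup.induction_on with
  | H x =>
    rw [finiteUnitClass_eq, IdeleClassGroup.mk_apply, ← QuotientGroup.mk_mul, meyerSum_mk, meyerSum_mk,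
      ideleSum_mul_finiteIdele_eq hF hu]

/-- `λ_{finiteUnitClass u} (Σ F) = Σ F` for the units `u` fixing `F`. [cite: Meyer2005, §5.3] -/
theorem classTranslate_finiteUnitClass_meyerSum {F : AdeleRing (𝓞 K) K → ℂ} {𝔫 : Ideal (𝓞 K)}
    (hF : ∀ u ∈ congruenceUnits K 𝔫, ∀ y : AdeleRing (𝓞 K) K,
      F (y * (finIdele K u : AdeleRing (𝓞 K) K)) = F y)
    {u : (FiniteAdeleRing (𝓞 K) K)ˣ} (hu : u ∈ congruenceUnits K 𝔫) :
    classTranslate K (finiteUnitClass K u) (meyerSum K F) = meyerSum K F := by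
  funext c
  rw [classTranslate_apply,
    show (finiteUnitClass K u)⁻¹ * c = c * (finiteUnitClass K u)⁻¹ from
      mul_comm ((finiteUnitClass K u)⁻¹) c, ← map_inv]
  exact meyerSum_mul_finiteUnitClass_eq hF (inv_mem hu) c

variable [MeasurableSpace (AdeleRing (𝓞 K) K)] [BorelSpace (AdeleRing (𝓞 K) K)]
  (μ : Measure (AdeleRing (𝓞 K) K)) [μ.IsAddHaarMeasure]

/-- **`𝔉F` is invariant under the finite idele units fixing `F`** (`𝔉(F(x·)) = |x|⁻¹𝔉F(x⁻¹·)`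
with `F(x ·) = F` and `|x| = 1`). [cite: Meyer2005, §5.3] -/
theorem adeleFourier_mul_finIdele_eq {F : AdeleRing (𝓞 K) K → ℂ} {𝔫 : Ideal (𝓞 K)}
    (hF : ∀ u ∈ congruenceUnits K 𝔫, ∀ y : AdeleRing (𝓞 K) K,
      F (y * (finIdele K u : AdeleRing (𝓞 K) K)) = F y)
    {u : (FiniteAdeleRing (𝓞 K) K)ˣ} (hu : u ∈ congruenceUnits K 𝔫) (ξ : AdeleRing (𝓞 K) K) :
    adeleFourier K μ F (ξ * (finIdele K u : AdeleRing (𝓞 K) K)) = adeleFourier K μ F ξ := by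
  -- `𝔉F η = 𝔉F ((1,w⁻¹) η)` for `w ∈ U(𝔫)`
  have key : ∀ w ∈ congruenceUnits K 𝔫, ∀ η : AdeleRing (𝓞 K) K,
      adeleFourier K μ F η = adeleFourier K μ F ((finIdele K w⁻¹ : AdeleRing (𝓞 K) K) * η) := by
    intro w hw η
    have h1 := adeleFourier_comp_mul μ F (finIdele K w) η
    have hF1 : (fun y => F ((finIdele K w : AdeleRing (𝓞 K) K) * y)) = F := by
      funext y
      rw [mul_comm]
      exact hF w hw y
    have hn1 : IdeleClassGroup.ideleNorm K (finIdele K w)⁻¹ = 1 := by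
      rw [← map_inv]
      exact ideleNorm_finIdele_eq_one (congruenceUnits_le_integralFiniteUnits 𝔫 (inv_mem hw))
    rw [hF1, hn1, NNReal.coe_one, Complex.ofReal_one, one_mul, ← map_inv] at h1
    exact h1
  rw [key u hu (ξ * (finIdele K u : AdeleRing (𝓞 K) K)), mul_comm ξ, ← mul_assoc,
    ← Units.val_mul, ← map_mul, inv_mul_cancel, map_one, Units.val_one, one_mul]

/-- **`i₊ F` is fixed by the finite idele units fixing `F`**: `(λ ⊕ λ)_{(1,u)} (i₊ F) = i₊ F`
for `u ∈ U(𝔫)` when `F` is `U(𝔫)`-invariant. [cite: Meyer2005, §5.3] -/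
theorem classTranslate₂_finiteUnitClass_iPlus {F : AdeleRing (𝓞 K) K → ℂ} {𝔫 : Ideal (𝓞 K)}
    (hF : ∀ u ∈ congruenceUnits K 𝔫, ∀ y : AdeleRing (𝓞 K) K,
      F (y * (finIdele K u : AdeleRing (𝓞 K) K)) = F y)
    {u : (FiniteAdeleRing (𝓞 K) K)ˣ} (hu : u ∈ congruenceUnits K 𝔫) :
    classTranslate₂ K (finiteUnitClass K u) (iPlus K μ F) = iPlus K μ F := by
  have hFF : ∀ u ∈ congruenceUnits K 𝔫, ∀ y : AdeleRing (𝓞 K) K,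
      adeleFourier K μ F (y * (finIdele K u : AdeleRing (𝓞 K) K)) =
        adeleFourier K μ F y := fun u hu y => adeleFourier_mul_finIdele_eq μ hF hu y
  rw [classTranslate₂_apply, iPlus]
  refine Prod.ext (classTranslate_finiteUnitClass_meyerSum hF hu) ?_
  funext c
  change classTranslate K (finiteUnitClass K u) (invJ K (meyerSum K (adeleFourier K μ F))) c =
    invJ K (meyerSum K (adeleFourier K μ F)) c
  have hc : ((finiteUnitClass K u)⁻¹ * c)⁻¹ = c⁻¹ * finiteUnitClass K u :=
    (mul_inv_rev ((finiteUnitClass K u)⁻¹) c).trans (congrArg _ (inv_inv (finiteUnitClass K u)))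
  have hn : classNorm K ((finiteUnitClass K u)⁻¹ * c) = classNorm K c := by
    rw [classNorm_mul, ← map_inv, classNorm_finiteUnitClass (congruenceUnits_le_integralFiniteUnits 𝔫 (inv_mem hu)),
      one_mul]
  rw [classTranslate_apply, invJ_apply, invJ_apply, hn, hc, meyerSum_mul_finiteUnitClass_eq hFF hu]

/-- **Every vector of `H₊` is fixed by an open subgroup of the finite idele units.**
[cite: Meyer2005, §5.2] -/
theorem exists_openSubgroup_forall_classTranslate₂_eq_of_mem_Hplus
    {p : (IdeleClassGroup K → ℂ) × (IdeleClassGroup K → ℂ)} (hp : p ∈ Hplus K μ) :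
    ∃ U : OpenSubgroup (FiniteAdeleRing (𝓞 K) K)ˣ, ∀ u ∈ U, classTranslate₂ K (finiteUnitClass K u) p = p := by
  induction hp using Submodule.span_induction with
  | mem p h =>
    obtain ⟨c, F, hF, rfl⟩ := h
    obtain ⟨𝔫, -, hinv⟩ := exists_ideal_forall_mul_finIdele_eq hF
    refine ⟨congruenceUnits K 𝔫, fun u hu => ?_⟩
    rw [← Module.End.mul_apply, ← map_mul,
      show finiteUnitClass K u * c = c * finiteUnitClass K u from mul_comm (finiteUnitClass K u) c, map_mul,
      Module.End.mul_apply,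
      classTranslate₂_finiteUnitClass_iPlus μ hinv hu]
  | zero => exact ⟨⊤, fun u _ => map_zero _⟩
  | add p q _ _ ihp ihq =>
    obtain ⟨U, hU⟩ := ihp
    obtain ⟨V, hV⟩ := ihq
    exact ⟨U ⊓ V, fun u hu => by rw [map_add, hU u hu.1, hV u hu.2]⟩
  | smul a p _ ih =>
    obtain ⟨U, hU⟩ := ih
    exact ⟨U, fun u hu => by rw [map_smul, hU u hu]⟩

omit [MeasurableSpace (AdeleRing (𝓞 K) K)] [BorelSpace (AdeleRing (𝓞 K) K)] in
/-- **Every vector of `i₋(H₋)` is fixed by an open subgroup of the finite idele units** (field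
`exists_openSubgroup` of `IsIdeleClassSchwartz`, for the weight `α = 0`). [cite: Meyer2005, §4.1] -/
theorem exists_openSubgroup_forall_classTranslate₂_eq_of_mem_HminusIm
    {p : (IdeleClassGroup K → ℂ) × (IdeleClassGroup K → ℂ)} (hp : p ∈ HminusIm K) :
    ∃ U : OpenSubgroup (FiniteAdeleRing (𝓞 K) K)ˣ, ∀ u ∈ U, classTranslate₂ K (finiteUnitClass K u) p = p := by
  obtain ⟨f, hf, rfl⟩ := hp
  have hf0 : f ∈ ideleClassSchwartz K := by
    have h := (mem_ideleClassSchwartzWeighted_iff.mp hf) 0 (Set.mem_univ _)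
    have hw : weightMul K 0 f = f := by
      funext x
      rw [weightMul_apply, Real.rpow_zero, Complex.ofReal_one, mul_one]
    rwa [hw] at h
  obtain ⟨U, hU⟩ := (mem_ideleClassSchwartz_iff.mp hf0).exists_openSubgroup
  refine ⟨U, fun u hu => ?_⟩
  have hinv : classTranslate K (finiteUnitClass K u) f = f := by
    funext x
    rw [classTranslate_apply,
      show (finiteUnitClass K u)⁻¹ * x = x * (finiteUnitClass K u)⁻¹ from
        mul_comm ((finiteUnitClass K u)⁻¹) x, ← map_inv]
    exact hU u⁻¹ (inv_mem hu) x
  rw [iMinus_apply, classTranslate₂_apply, hinv]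

/-- **Every vector of `H₊ + H₋` is fixed by an open subgroup of the finite idele units** (smoothness
of the representation of `C_K` on `𝒮(C_K)_{><}` in the totally disconnected directions).
[cite: Meyer2005, §5.2] -/
theorem exists_openSubgroup_forall_classTranslate₂_eq_of_mem_Hsum
    {p : (IdeleClassGroup K → ℂ) × (IdeleClassGroup K → ℂ)} (hp : p ∈ Hsum K μ) :
    ∃ U : OpenSubgroup (FiniteAdeleRing (𝓞 K) K)ˣ, ∀ u ∈ U, classTranslate₂ K (finiteUnitClass K u) p = p := by
  obtain ⟨a, ha, b, hb, rfl⟩ := Submodule.mem_sup.mp hp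
  obtain ⟨U, hU⟩ := exists_openSubgroup_forall_classTranslate₂_eq_of_mem_Hplus μ ha
  obtain ⟨V, hV⟩ := exists_openSubgroup_forall_classTranslate₂_eq_of_mem_HminusIm hb
  exact ⟨U ⊓ V, fun u hu => by rw [map_add, hU u hu.1, hV u hu.2]⟩

/-- The representation `sumRep` on `H₊ + H₋` fixes every vector on an open subgroup.
[cite: Meyer2005, §5.2] -/
theorem exists_openSubgroup_forall_sumRep_eq (p : Hsum K μ) :
    ∃ U : OpenSubgroup (FiniteAdeleRing (𝓞 K) K)ˣ, ∀ u ∈ U, sumRep K μ (finiteUnitClass K u) p = p := by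
  obtain ⟨U, hU⟩ := exists_openSubgroup_forall_classTranslate₂_eq_of_mem_Hsum μ p.2
  refine ⟨U, fun u hu => Subtype.ext ?_⟩
  rw [sumRep, Representation.subrepresentation_apply, LinearMap.restrict_apply]
  exact hU u hu

end Hsum

/-! ### Finite order modulo an open subgroup, and the reduction -/

section Reduction

variable {K : Type} [Field K] [NumberField K]

variable [MeasurableSpace (AdeleRing (𝓞 K) K)] [BorelSpace (AdeleRing (𝓞 K) K)]
  (μ : Measure (AdeleRing (𝓞 K) K)) [μ.IsAddHaarMeasure]

/-- **A finite-dimensional subspace of `H⁰₋` is fixed pointwise by an open subgroup** of the finite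
idele units (pick representatives of a basis in `H₊ + H₋` and intersect their open stabilisers).
[cite: Meyer2005, §5.2] -/
theorem exists_openSubgroup_forall_piMinus_eq (W : Submodule ℂ (HzeroMinus K μ)) [FiniteDimensional ℂ W] :
    ∃ U : OpenSubgroup (FiniteAdeleRing (𝓞 K) K)ˣ, ∀ u ∈ U, ∀ w ∈ W, piMinus K μ (finiteUnitClass K u) w = w := by
  classical
  haveI : Module.Free ℂ W := Module.Free.of_divisionRing ℂ W
  set b := Module.finBasis ℂ W
  -- representatives of the basis vectors
  have hrep : ∀ i, ∃ p : Hsum K μ, Submodule.Quotient.mk p = (b i : HzeroMinus K μ) := fun i =>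
    Submodule.Quotient.mk_surjective _ _
  choose p hp using hrep
  obtain ⟨U, hU⟩ := exists_openSubgroup_forall (ι := Fin (Module.finrank ℂ W))
    (P := fun i u => sumRep K μ (finiteUnitClass K u) (p i) = p i)
    (fun i => exists_openSubgroup_forall_sumRep_eq μ (p i))
  refine ⟨U, fun u hu w hw => ?_⟩
  -- the two linear maps `π₋(u) ∘ ι_W` and `ι_W` agree on the basis
  have hb : ∀ i, piMinus K μ (finiteUnitClass K u) (b i : HzeroMinus K μ) = b i := by
    intro i
    rw [← hp i, piMinus, Representation.quotient_apply, Submodule.mapQ_apply, hU u hu i]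
  have hlin : (piMinus K μ (finiteUnitClass K u)) ∘ₗ W.subtype = W.subtype :=
    b.ext fun i => by simp only [LinearMap.coe_comp, Function.comp_apply, Submodule.coe_subtype, hb]
  exact LinearMap.congr_fun hlin ⟨w, hw⟩

/-- **The unramified reduction** [Meyer2005, §5.1–5.2, applied in §5.7]: for a finite-dimensional
`C_K`-invariant subspace `W ≤ H⁰₋ = (H₊ + H₋)/H₊`, a vector `v ∈ W` in the joint generalised
eigenspace of the unramified quasi-character `|x|^s`, and an integral finite idele unit
`u ∈ 𝒪̂ˣ`: `π₋(u) v = v`. (The image of `𝒪̂ˣ` acts on `W` through a finite quotient — `W` is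
fixed by an open subgroup, in which `u` has a positive power — and `|u|^s = 1`, so `π₋(u)|_W`
has finite order and is unipotent on `v`: `rep_apply_eq_self_of_pow_eq_self_on`.)
[cite: Meyer2005, §5.1] -/
theorem piMinus_finiteUnitClass_eq_self (W : Submodule ℂ (HzeroMinus K μ)) [FiniteDimensional ℂ W]
    (hW : ∀ g, W ≤ W.comap (piMinus K μ g)) (s : ℂ) {v : HzeroMinus K μ}
    (hv : v ∈ W ⊓ jointGenEigenspace (piMinus K μ) (normChar K s))
    {u : (FiniteAdeleRing (𝓞 K) K)ˣ} (hu : u ∈ integralFiniteUnits K) :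
    piMinus K μ (finiteUnitClass K u) v = v := by
  obtain ⟨U, hU⟩ := exists_openSubgroup_forall_piMinus_eq μ W
  obtain ⟨m, hm, hum⟩ := exists_pow_mem_of_isOpen U hu
  refine rep_apply_eq_self_of_pow_eq_self_on (piMinus K μ) (normChar K s) W hW (finiteUnitClass K u)
    (normChar_finiteUnitClass s hu) hm (fun w hw => ?_) hv
  rw [← map_pow]
  exact hU (u ^ m) hum w hw

end Reduction

end Literature.NumberTheory.Automorphic.Meyer
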